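import Summits.CriticalPhenomena.PercolationContinuityZ3.Theses.PercLoopDislocationCovers
import Literature.Probability.Percolation.CoveringMonotonicity
import HarnessLib

/-!
# `PercLoopDislocationCovers.CoverMonotone` (stmt-CriticalPhenomena-6531) PROVED — covering monotonicity

RSW3 lane (lead, gen 29).  Item `stmt-CriticalPhenomena-6531` of route `CriticalPhenomena/PercLoopDislocationCovers` (support,
'provable now'): for a vertex map `φ : V → W` mapping the `G`-neighbourhood of every vertex ONTO the `H`-neighbourhood of its
image, `θ_H(φ v, p) ≤ θ_G(v, p)` for all `v`, `p` (Campanino 1985; Benjamini–Schramm 1996 Thm 1; Lyons–Peres 2016 Thm 6.47).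
This is literally the tree's `LyonsPeres647.theta_le_of_surjOn_neighborSet` (the exploration coupling of the printed proof,
which needs neither `0 < p < 1` nor that `φ` be a homomorphism); the same one-liner closed the homonymous item of the retired
route `PercDislocationCovers` (gen 28) — the present route decl had remained open.

References: R. Lyons, Y. Peres (2016), Thm 6.47 [LyonsPeres2016]; I. Benjamini, O. Schramm (1996), Thm 1 [BenjaminiSchramm1996].
-/

noncomputable section

namespace Summit.CriticalPhenomena.PercolationContinuityZ3.Theorems

namespace PercLoopDislocationCoversCoverMonotone

open Literature.Probability.Percolation

/-- **`PercLoopDislocationCovers.CoverMonotone` (stmt-CriticalPhenomena-6531).**  `θ_H(φ v, p) ≤ θ_G(v, p)` for weak coverings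
`φ` (neighbourhood-onto vertex maps), all `v`, `p`. [cite: LyonsPeres2016, Thm. 6.47] -/
theorem coverMonotone_proof : Summit.CriticalPhenomena.PercolationContinuityZ3.Theses.PercLoopDislocationCovers.CoverMonotone := by
  unfold Summit.CriticalPhenomena.PercolationContinuityZ3.Theses.PercLoopDislocationCovers.CoverMonotone
  intro V W _ _ G H φ hφ v p
  exact LyonsPeres647.theta_le_of_surjOn_neighborSet G H φ hφ v p

end PercLoopDislocationCoversCoverMonotone

end Summit.CriticalPhenomena.PercolationContinuityZ3.Theorems

end
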